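import Literature.Probability.LatticeModels.AnnealedDeviceCorr
import Literature.Analysis.FunctionSpaces.PoissonDistinctValues
import HarnessLib

/-!
# Crux `ConformalPoissonDevice.DeviceWeylUniversality` (stmt-CriticalPhenomena-4722), line `birth` —
# stub D0 `stub_deviceZero`

Route `ConformalPoissonDevice`, sub-problem `Ising3DConformalLimit`; stub D0 of the lead's reshaped
skeleton of the line `birth` (`Cruxes/DeviceWeylUniversality/Lines/birth.lean`): **the `0`-point
annealed device correlator is `1`.**

The device of the route is the Poisson point process on `ℝ³` of intensity
`ν_N = N (1 + ‖z‖²)⁻³ dz` (the uniform process of `S³` read stereographically). Its total mass is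
`N · ∫ (1 + ‖z‖²)⁻³ dz < ∞` (Mathlib `integrable_rpow_neg_one_add_norm_sq` with `r = 6 > 3 = dim`),
so the configuration is almost surely FINITE (`IsPoissonPointProcess.ae_finite`, Kingman 1993 §2.1).
Since `annealedDeviceCorr P β 0 x = P.real {ω finite}` (`annealedDeviceCorr_zero`: at `n = 0` the
quenched Gibbs average is the indicator of the finite configurations — empty product `1` on finite
ones, junk `0` on infinite ones), the `0`-point correlator of the route's laws is `1`.

Contents:
* `deviceZero_lintegral_density_lt_top` — `∫⁻ ofReal ((1 + ‖z‖²)⁻³) dz < ∞` on `ℝ³`;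
* `deviceZero_intensity_univ_ne_top` — `ν_N(ℝ³) ≠ ∞`;
* `deviceZero_measure_setOf_finite_eq_one` — `(P N) {ω finite} = 1`;
* `stub_deviceZero` — the registered stub, verbatim.

Sources: J. F. C. Kingman, *Poisson Processes*, Oxford (1993), §2.1 (a Poisson process of finite
total intensity has a.s. finitely many points); tree API
`Literature/Probability/LatticeModels/AnnealedDeviceCorr.lean` (`annealedDeviceCorr_zero`,
`measurableSet_setOf_coe_finite`), `Literature/Analysis/FunctionSpaces/PoissonDistinctValues.lean`
(`IsPoissonPointProcess.ae_finite`). Nothing about `n ≥ 1` is here (other stubs of the line).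
-/

noncomputable section

open MeasureTheory
open Literature.Analysis.FunctionSpaces Literature.Probability.LatticeModels
open scoped ENNReal

namespace Summit.CriticalPhenomena.Ising3DConformalLimit.Theorems.DeviceWeylUniversality

/-- The conformal density `(1 + ‖z‖²)⁻³` has finite Lebesgue integral on `ℝ³`
(`∫ (1 + ‖z‖²)^{-r/2} dz < ∞` for `r = 6 > 3 = dim ℝ³`; its value is `π²/4`, not needed here).
[folklore] -/
theorem deviceZero_lintegral_density_lt_top :
    ∫⁻ z : EuclideanSpace ℝ (Fin 3), ENNReal.ofReal ((1 + ‖z‖ ^ 2) ^ (-(3:ℝ))) < ∞ := by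
  have h := integrable_rpow_neg_one_add_norm_sq (E := EuclideanSpace ℝ (Fin 3))
    (μ := (volume : Measure (EuclideanSpace ℝ (Fin 3)))) (r := 6)
    (by rw [finrank_euclideanSpace_fin]; norm_num)
  have h2 : (-(6:ℝ)) / 2 = -(3:ℝ) := by norm_num
  rw [h2] at h
  exact h.lintegral_lt_top

/-- The total intensity of the route's device at level `N` is finite:
`ν_N(ℝ³) = N · ∫ (1 + ‖z‖²)⁻³ dz ≠ ∞`. [folklore] -/
theorem deviceZero_intensity_univ_ne_top (N : ℕ) :
    ((N : ENNReal) • (volume : Measure (EuclideanSpace ℝ (Fin 3))).withDensity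
        (fun z => ENNReal.ofReal ((1 + ‖z‖ ^ 2) ^ (-(3:ℝ))))) Set.univ ≠ ∞ := by
  rw [Measure.smul_apply, withDensity_apply _ MeasurableSet.univ, Measure.restrict_univ,
    smul_eq_mul]
  exact ENNReal.mul_ne_top (ENNReal.natCast_ne_top N) deviceZero_lintegral_density_lt_top.ne

/-- A Poisson law with the route's intensity `ν_N` gives probability `1` to the finite
configurations (Kingman 1993, §2.1: `N(ℝ³) ~ Po(ν_N(ℝ³))` with `ν_N(ℝ³) < ∞`).
[cite: Kingman1993, §2.1] -/
theorem deviceZero_measure_setOf_finite_eq_one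
    {P : Measure (PointConfig (EuclideanSpace ℝ (Fin 3)))} {N : ℕ}
    (hP : IsPoissonPointProcess ((N : ENNReal) •
      (volume : Measure (EuclideanSpace ℝ (Fin 3))).withDensity
        (fun z => ENNReal.ofReal ((1 + ‖z‖ ^ 2) ^ (-(3:ℝ))))) P) :
    P {ω | (ω : Set (EuclideanSpace ℝ (Fin 3))).Finite} = 1 := by
  haveI := hP.isProbabilityMeasure
  exact (mem_ae_iff_prob_eq_one measurableSet_setOf_coe_finite).1
    (hP.ae_finite (deviceZero_intensity_univ_ne_top N))

/-- **Stub D0 of line `birth` (crux stmt-CriticalPhenomena-4722) — the `0`-point device correlator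
is `1`.** For the route's Poisson laws `P N` (intensity `N (1 + ‖z‖²)⁻³ dz` on `ℝ³`, finite total
mass), `annealedDeviceCorr (P N) β 0 x = (P N).real {ω finite} = 1` (`annealedDeviceCorr_zero` and
a.s. finiteness of a Poisson process of finite intensity, Kingman 1993 §2.1).
[cite: Kingman1993, §2.1] -/
theorem stub_deviceZero :
    ∀ (P : ℕ → MeasureTheory.Measure
      (Literature.Analysis.FunctionSpaces.PointConfig (EuclideanSpace ℝ (Fin 3)))),
    (∀ N : ℕ, Literature.Analysis.FunctionSpaces.IsPoissonPointProcess ((N : ENNReal) •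
      (MeasureTheory.volume : MeasureTheory.Measure (EuclideanSpace ℝ (Fin 3))).withDensity
        (fun z => ENNReal.ofReal ((1 + ‖z‖ ^ 2) ^ (-(3:ℝ))))) (P N))
    → ∀ (β : ℝ) (N : ℕ) (x : Fin 0 → EuclideanSpace ℝ (Fin 3)),
      Literature.Probability.LatticeModels.annealedDeviceCorr (P N) β 0 x = 1 := by
  intro P hP β N x
  rw [annealedDeviceCorr_zero, measureReal_def, deviceZero_measure_setOf_finite_eq_one (hP N),
    ENNReal.toReal_one]

end Summit.CriticalPhenomena.Ising3DConformalLimit.Theorems.DeviceWeylUniversality
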